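import Mathlib.MeasureTheory.Measure.Hausdorff
import Mathlib.Analysis.SpecialFunctions.Pow.NNReal
import HarnessLib

/-!
# Uniform ball growth `μ(B̄(z,r)) ≤ C r^s` forces absolute continuity with respect to `𝓗^s`

Support file (all results proved) for the barrier
`Literature.Barriers.AnomalousDissipation.DeRosaDrivasInversi2024_thm12_bounded`
(De Rosa–Drivas–Inversi 2024: the anomalous dissipation of bounded Euler flows is absolutely
continuous with respect to the `d`-dimensional space–time Hausdorff measure), whose last step is
the elementary covering lemma turning a uniform estimate on small balls into absolute continuity
(De Rosa–Drivas–Inversi, J. Math. Fluid Mech. 26 (2024), arXiv:2301.09603, Lemma 2.3 "Absolute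
continuity vs cylinders asymptotic", in the isotropic case `α = 1` where the cylinders are metric
balls; this is the easy implication `(b) ⇒ (a)` of Frostman's lemma, Mattila, *Geometry of sets
and measures in Euclidean spaces*, Thm. 8.8, i.e. the mass distribution principle, Falconer,
*Fractal geometry*, Principle 4.2).

## Contents

* `smul_restrict_le_hausdorffMeasure_of_closedBall_le` — if `μ(B̄(z, r)) ≤ C r^s` for all
  `z ∈ K`, `0 < r ≤ r₀` (`s > 0`, `K` measurable), then `(max C 1)⁻¹ • μ|_K ≤ μH[s]`
  (Mathlib's `Measure.le_hausdorffMeasure` is exactly the mass distribution principle: it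
  suffices to bound the measure of every set of small diameter by `diam^s`; a set of diameter
  `ρ` meeting `K` at `z` lies in `B̄(z, ρ)`, and sets of diameter `0` are handled by letting
  `r → 0`).
* `absolutelyContinuous_restrict_hausdorffMeasure_of_closedBall_le` — hence `μ|_K ≪ μH[s]`
  (De Rosa–Drivas–Inversi 2024, Lemma 2.3 with `α = 1`, `ω ≡ C`).

Stated in a general metric space with its Borel σ-algebra, for Mathlib's (unnormalised)
Hausdorff measure `μH[s]`; the anisotropic measures `𝓗^s_α`, `α ≠ 1`, of op. cit. Def. 2.1 are
not in Mathlib and are NOT treated, nor is the refinement for a modulus of continuity `ω`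
(second half of Lemma 2.3).

## References

* L. De Rosa, T. D. Drivas, M. Inversi, *On the support of anomalous dissipation measures*,
  J. Math. Fluid Mech. 26 (2024), arXiv:2301.09603, §2.1, Lemma 2.3, Cor. 2.4, Lemma 2.5.
* P. Mattila, *Geometry of sets and measures in Euclidean spaces* (CUP 1995), Thm. 8.8.
* K. Falconer, *Fractal geometry*, 3rd ed. (2014), Principle 4.2.
-/

noncomputable section

open Set Filter Function Metric
open _root_.MeasureTheory _root_.MeasureTheory.Measure
open scoped ENNReal NNReal Topology

namespace Literature.MeasureTheory.Hausdorff

variable {X : Type*} [MetricSpace X] [MeasurableSpace X] [BorelSpace X]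

/-- **Mass distribution principle, local form.** If a measure `μ` satisfies the uniform ball
growth `μ(B̄(z, r)) ≤ C r^s` for every centre `z` in a measurable set `K` and every radius
`0 < r ≤ r₀` (`s > 0`), then `(max C 1)⁻¹ • μ|_K ≤ μH[s]` as measures: every set of diameter
`ρ ≤ r₀` meeting `K` at `z` is contained in `B̄(z, ρ)` and so has `μ|_K`-mass `≤ C ρ^s`
(Mattila, Thm. 8.8 `(b) ⇒ (a)`; Falconer, Principle 4.2; De Rosa–Drivas–Inversi 2024, proof of
Lemma 2.3). Via Mathlib's `Measure.le_hausdorffMeasure`. [folklore] -/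
theorem smul_restrict_le_hausdorffMeasure_of_closedBall_le (μ : Measure X) {K : Set X}
    (hK : MeasurableSet K) {s : ℝ} (hs : 0 < s) {C r₀ : ℝ} (hr₀ : 0 < r₀)
    (h : ∀ z ∈ K, ∀ r : ℝ, 0 < r → r ≤ r₀ → μ (closedBall z r) ≤ ENNReal.ofReal (C * r ^ s)) :
    (ENNReal.ofReal (max C 1))⁻¹ • μ.restrict K ≤ μH[s] := by
  set C' := max C 1 with hC'
  have hC'pos : 0 < C' := lt_of_lt_of_le one_pos (le_max_right _ _)
  have hC'0 : ENNReal.ofReal C' ≠ 0 := by simpa using hC'pos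
  -- the hypothesis with the larger constant `C'`
  have h' : ∀ z ∈ K, ∀ r : ℝ, 0 < r → r ≤ r₀ →
      μ (closedBall z r) ≤ ENNReal.ofReal (C' * r ^ s) := fun z hz r hr hrr =>
    (h z hz r hr hrr).trans (ENNReal.ofReal_le_ofReal
      (mul_le_mul_of_nonneg_right (le_max_left _ _) (Real.rpow_nonneg hr.le s)))
  refine le_hausdorffMeasure s _ (ENNReal.ofReal r₀) (by simpa using hr₀) fun t ht => ?_
  rw [Measure.smul_apply, smul_eq_mul]
  by_cases hne : (t ∩ K).Nonempty
  · obtain ⟨z, hzt, hzK⟩ := hne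
    have hfin : ediam t ≠ ∞ := ne_top_of_le_ne_top ENNReal.ofReal_ne_top ht
    set ρ := (ediam t).toReal with hρ
    have hρ0 : 0 ≤ ρ := ENNReal.toReal_nonneg
    have hρr : ρ ≤ r₀ := by
      have := ENNReal.toReal_mono ENNReal.ofReal_ne_top ht
      rwa [ENNReal.toReal_ofReal hr₀.le] at this
    -- `t ⊆ B̄(z, r)` for every `r ≥ ρ`
    have hsub : ∀ r, ρ ≤ r → t ⊆ closedBall z r := fun r hr y hy => by
      rw [mem_closedBall, dist_edist]
      exact (ENNReal.toReal_mono hfin (edist_le_ediam_of_mem hy hzt)).trans hr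
    have hbound : ∀ r, 0 < r → r ≤ r₀ → ρ ≤ r →
        (ENNReal.ofReal C')⁻¹ * μ.restrict K t ≤ ENNReal.ofReal (r ^ s) := by
      intro r hr hrr hρr'
      calc (ENNReal.ofReal C')⁻¹ * μ.restrict K t
          ≤ (ENNReal.ofReal C')⁻¹ * μ.restrict K (closedBall z r) := by
            gcongr
            exact hsub r hρr'
        _ ≤ (ENNReal.ofReal C')⁻¹ * μ (closedBall z r) := by
            gcongr
            exact Measure.restrict_le_self
        _ ≤ (ENNReal.ofReal C')⁻¹ * ENNReal.ofReal (C' * r ^ s) := by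
            gcongr
            exact h' z hzK r hr hrr
        _ = ENNReal.ofReal (r ^ s) := by
            rw [ENNReal.ofReal_mul hC'pos.le, ← mul_assoc,
              ENNReal.inv_mul_cancel hC'0 ENNReal.ofReal_ne_top, one_mul]
    rcases hρ0.eq_or_lt with hρ0' | hρpos
    · -- diameter `0`: let `r → 0`
      have hzero : (ENNReal.ofReal C')⁻¹ * μ.restrict K t ≤ 0 := by
        refine ENNReal.le_of_forall_pos_le_add fun ε hε _ => ?_
        rw [zero_add]
        have hεpos : (0 : ℝ) < ε := by exact_mod_cast hε
        set r := min r₀ ((ε : ℝ) ^ s⁻¹) with hr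
        have hrpos : 0 < r := lt_min hr₀ (Real.rpow_pos_of_pos hεpos _)
        calc (ENNReal.ofReal C')⁻¹ * μ.restrict K t ≤ ENNReal.ofReal (r ^ s) :=
              hbound r hrpos (min_le_left _ _) (by rw [← hρ0']; exact hrpos.le)
          _ ≤ ENNReal.ofReal (ε : ℝ) := by
              refine ENNReal.ofReal_le_ofReal ?_
              calc r ^ s ≤ ((ε : ℝ) ^ s⁻¹) ^ s :=
                    Real.rpow_le_rpow hrpos.le (min_le_right _ _) hs.le
                _ = ε := Real.rpow_inv_rpow hεpos.le hs.ne'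
          _ = ε := ENNReal.ofReal_coe_nnreal
      exact hzero.trans (_root_.zero_le)
    · calc (ENNReal.ofReal C')⁻¹ * μ.restrict K t ≤ ENNReal.ofReal (ρ ^ s) :=
            hbound ρ hρpos hρr le_rfl
        _ = ediam t ^ s := by
            rw [← ENNReal.ofReal_rpow_of_nonneg hρ0 hs.le, hρ, ENNReal.ofReal_toReal hfin]
  · rw [Measure.restrict_apply' hK, Set.not_nonempty_iff_eq_empty.1 hne, measure_empty, mul_zero]
    exact _root_.zero_le

/-- **Uniform ball growth implies absolute continuity with respect to `𝓗^s`.** If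
`μ(B̄(z, r)) ≤ C r^s` for all `z` in a measurable set `K` and all `0 < r ≤ r₀` (`s > 0`), then the
restriction `μ|_K` is absolutely continuous with respect to the `s`-dimensional Hausdorff measure
(De Rosa–Drivas–Inversi, arXiv:2301.09603, Lemma 2.3 with `α = 1` and `ω ≡ C`: "Then, `μ` is
absolutely continuous with respect to `𝓗^s_α`"; Mattila, Thm. 8.8). From
`smul_restrict_le_hausdorffMeasure_of_closedBall_le`. [cite: DeRosaDrivasInversi2024, Lemma 2.3] -/
theorem absolutelyContinuous_restrict_hausdorffMeasure_of_closedBall_le (μ : Measure X)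
    {K : Set X} (hK : MeasurableSet K) {s : ℝ} (hs : 0 < s) {C r₀ : ℝ} (hr₀ : 0 < r₀)
    (h : ∀ z ∈ K, ∀ r : ℝ, 0 < r → r ≤ r₀ → μ (closedBall z r) ≤ ENNReal.ofReal (C * r ^ s)) :
    μ.restrict K ≪ μH[s] := by
  have hle := smul_restrict_le_hausdorffMeasure_of_closedBall_le μ hK hs hr₀ h
  refine Measure.AbsolutelyContinuous.mk fun t _ ht0 => ?_
  have h1 : ((ENNReal.ofReal (max C 1))⁻¹ • μ.restrict K) t ≤ μH[s] t := Measure.le_iff'.1 hle t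
  rw [ht0, nonpos_iff_eq_zero, Measure.smul_apply, smul_eq_mul, mul_eq_zero] at h1
  exact h1.resolve_left (ENNReal.inv_ne_zero.2 ENNReal.ofReal_ne_top)

end Literature.MeasureTheory.Hausdorff
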